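import Literature.NumberTheory.GaloisRepresentations.LevelFieldLocalization
import Literature.NumberTheory.GaloisRepresentations.CyclotomicCharacterSurjectiveProofs
import Mathlib.RingTheory.Polynomial.Cyclotomic.Roots
import HarnessLib

/-!
# Choosing the twist `σ_w ∈ Γ_ℚ` that realises a prescribed place of the level field
# (crux `KatoKuriharaPortThreeShared`, stmt-BirchSwinnertonDyer-19560, hK / hKloc clauses (f) and (C3b);
# cell `bsd-addord`, seat w2-acc5 gen 4; route W2 `KimAtThreeKolyvagin`; `--supports 19560`, helper)

HONEST FRAMING. TOOL theorems only (no definition, no named fact, no `sorry`); closes nothing; nothing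
is booked; BSD is not proved by any of this.  `KimAtThreeFineKatoLevelCompatTwist` (p498449) shows that
the per-factor COMPAT clause and the (C3b) clause hold for the TWISTED tower localisations
`loc^{tower} ∘ conjMap σ`, `σ ∈ Γ_ℚ`, at a completion `F = L_w` of the level field `L = ℚ(ζ_m)`: the
twist is how the `g` distinct places `w ∣ p` are reached from ONE base place (`LevelFieldLocalization`
§4: every tower restriction lands in `U ⊓ D_{𝔓₀}`).  Which `σ` belongs to the place `w` — i.e. to the
structure embedding `ι_w : L → L_w` of the model — is fixed by where `σ` moves a primitive `m`-th root of
unity `ζ₀ ∈ ℚ̄` under the tower embedding `j = ι_{F/E} ∘ ι_{E/ℚ} : ℚ̄ → F̄`: one wants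
`j (σ • ζ₀) = ι_w(ζ)` (then `loc^{tower} ∘ conjMap σ` reads a level class through an embedding
`ℚ̄ → \bar L_w` that extends `ι_w` on `ℚ(ζ₀) = ℚ̄^U`, and `σ` is determined modulo `U`, which acts
trivially on `H¹(U, ·)` — `ConjugationDescent.conjMap_eq_self_of_mem_one`).  THIS FILE proves that such
a `σ` EXISTS for every prescribed primitive `m`-th root of unity `ξ` of `F̄` — `Gal(ℚ(ζ_m)/ℚ) = (ℤ/m)ˣ`
(irreducibility of `Φ_m` over `ℚ`, Mathlib `Polynomial.cyclotomic.irreducible_rat`, through the tree's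
`RootOfUnityAction.exists_smul_eq_pow_and_smul_eq_self`):

* `exists_smul_primitiveRoot_map_eq` — for ANY `ℚ`-algebra map `j : ℚ̄ → Ω` into a field and
  primitive `m`-th roots `ζ₀ ∈ ℚ̄`, `ξ ∈ Ω`: `∃ σ : Γ_ℚ, j (σ • ζ₀) = ξ`;
* `exists_smul_primitiveRoot_towerEmbedding_eq` — the same for the tower embedding of fields
  `ℚ ⊆ E ⊆ F` (`E = ℚ_v`, `F = L_w`), `ξ` any primitive `m`-th root of `F̄` (e.g. the image of `ι_w(ζ)`).

So the Kato-v2 definer's `Λ(y)_w := exp*_w (loc^{tower} (H1toInt (σ_w · y)))` with `σ_w` so chosen IS the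
localisation at the place `w` of the model; its per-factor COMPAT / (C3b) are p498449 by name.

References: L. Washington, *Introduction to Cyclotomic Fields*, Thm. 2.5 [Washington1997]; K. Kato,
Astérisque 295 (2004) §9.4 [Kato2004Asterisque]; J.-P. Serre, *Local Fields* (1979) VII §5 [SerreLocalFields1979].
-/

noncomputable section

-- the cell's Theorems namespace `Summit.BirchSwinnertonDyer.BirchSwinnertonDyer.…` repeats the summit name by design (D-0017)
set_option linter.dupNamespace false

open Field Literature.NumberTheory.GaloisRepresentations

namespace Summit.BirchSwinnertonDyer.BirchSwinnertonDyer.Theorems.KimAtThreeFineKatoLevelTwistChoice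

/-- **Every primitive `m`-th root of unity of `Ω` is `j (σ • ζ₀)` for some `σ ∈ Γ_ℚ`**, for any
`ℚ`-algebra map `j : ℚ̄ → Ω` into a field and any primitive `m`-th root `ζ₀ ∈ ℚ̄`: `ξ = j(ζ₀)^i` with
`i` prime to `m`, and `ζ₀ ↦ ζ₀^i` extends to `Γ_ℚ` because `Φ_m` is irreducible over `ℚ`.
[cite: Washington1997, Thm. 2.5] -/
theorem exists_smul_primitiveRoot_map_eq {m : ℕ} [NeZero m] {Ω : Type*} [Field Ω] [Algebra ℚ Ω]
    (j : AlgebraicClosure ℚ →ₐ[ℚ] Ω) {ζ₀ : AlgebraicClosure ℚ} (hζ₀ : IsPrimitiveRoot ζ₀ m)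
    {ξ : Ω} (hξ : IsPrimitiveRoot ξ m) : ∃ σ : absoluteGaloisGroup ℚ, j (σ • ζ₀) = ξ := by
  have hj : IsPrimitiveRoot (j ζ₀) m := hζ₀.map_of_injective j.toRingHom.injective
  obtain ⟨i, hi, hiξ⟩ := hj.eq_pow_of_pow_eq_one hξ.pow_eq_one
  have hcop : i.Coprime m := by
    have h := hξ
    rw [← hiξ] at h
    exact (hj.pow_iff_coprime (NeZero.pos m) i).mp h
  have hirr : Irreducible (Polynomial.cyclotomic (m * 1) ℚ) := by
    rw [mul_one]
    exact Polynomial.cyclotomic.irreducible_rat (NeZero.pos m)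
  obtain ⟨σ, hσ, -⟩ := RootOfUnityAction.exists_smul_eq_pow_and_smul_eq_self (K := ℚ)
    (Nat.coprime_one_right m) hirr (ZMod.unitOfCoprime i hcop)
  refine ⟨σ, ?_⟩
  rw [hσ ζ₀ hζ₀.pow_eq_one, map_pow, ZMod.coe_unitOfCoprime, ZMod.val_natCast,
    Nat.mod_eq_of_lt hi, hiξ]

/-- **The twist realising a place**: for a tower of fields `ℚ ⊆ E ⊆ F` (intended `E = ℚ_v`, `F = L_w` a
completion of the level field) and any primitive `m`-th root of unity `ξ` of `F̄` (intended: the image of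
the model's `ι_w(ζ)`), there is `σ ∈ Γ_ℚ` with `ι_{F/E}(ι_{E/ℚ}(σ • ζ₀)) = ξ` — the embedding through
which `LevelFieldLocalization.locTower ∘ conjMap σ` reads level classes
(`absClosureEmbedding_absGaloisRestrictTower_smul`). [cite: Washington1997, Thm. 2.5] -/
theorem exists_smul_primitiveRoot_towerEmbedding_eq (E F : Type) [Field E] [Field F] [Algebra ℚ E]
    [Algebra E F] [Algebra ℚ F] [IsScalarTower ℚ E F] {m : ℕ} [NeZero m] {ζ₀ : AlgebraicClosure ℚ}
    (hζ₀ : IsPrimitiveRoot ζ₀ m) {ξ : AlgebraicClosure F} (hξ : IsPrimitiveRoot ξ m) :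
    ∃ σ : absoluteGaloisGroup ℚ,
      absClosureEmbedding E F (absClosureEmbedding ℚ E (σ • ζ₀)) = ξ :=
  exists_smul_primitiveRoot_map_eq
    (((absClosureEmbedding E F).restrictScalars ℚ).comp (absClosureEmbedding ℚ E)) hζ₀ hξ

/-- A primitive `m`-th root of unity of `F` (e.g. `ι_w(ζ)`, `ζ` the distinguished generator of the level
field) stays primitive in `F̄`. [folklore] -/
theorem isPrimitiveRoot_algebraMap_algebraicClosure {F : Type*} [Field F] {m : ℕ} {ζ : F}
    (hζ : IsPrimitiveRoot ζ m) : IsPrimitiveRoot (algebraMap F (AlgebraicClosure F) ζ) m :=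
  hζ.map_of_injective (algebraMap F (AlgebraicClosure F)).injective

end Summit.BirchSwinnertonDyer.BirchSwinnertonDyer.Theorems.KimAtThreeFineKatoLevelTwistChoice

end
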